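import Summits.HodgeConjecture.CorCM.Census.CoinvariantFloor

/-!
# The coinvariant fibre `φ₂(G, c)`, III: for `2`-GROUPS the coinvariant floor is attained mod `2`, by faces (`p`-group Nakayama)

COR-CM (cell `pub-hodgecm2`), count-neutral kernel combinatorics by the binder seat b09 (gen 29; lane COINVARIANT-FLOOR),
part III, sequel of `Census/CoinvariantFibre.lean` (I) and `Census/CoinvariantFloor.lean` (II).  Theorems only; no `decide`, no
certificate, no named fact, no `sorry`.  HONEST FRAMING: `HC_CM` is NOT proved; nothing here is a period or a headline.

WHY.  Part II proved `|S| ≥ φ₂(G, c)` for every family `S` of Hodge vectors generating the faces modulo pairs over `ℤ[G]` (hence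
mod `2` over `𝔽₂[G]`), and that `φ₂` of the faces always suffice modulo the RADICAL `rad2 = pairs + coboundaries`.  When `G` is a
`2`-group the augmentation ideal of `𝔽₂[G]` is nilpotent, so «modulo the radical» can be dropped (Nakayama): the coinvariant floor
is then EXACTLY the minimal number of Hodge generators mod `2`, and it is attained by faces — the mod-`2` shadow, proved for every
`2`-power order at once, of André-3's empirical law `μ = μ_F = fibre₂` (PORTFOLIO-g15 §0 (D); e.g. `Q₈ 2`, `D₄ 2`, `ℤ/8 1`,
`ℤ/4×ℤ/2 2`, `(ℤ/2)³ 3`, `ℤ/16 15`, `Q₁₆ 16`, `M₁₆ 17`, `ℤ/4×ℤ/4 18`, `SD₁₆ 19`, `D₈ 22`, `(ℤ/2)⁴ 28`).  Numerically (this gen,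
`py/nakayama_check.py`): for all `57` pairs `(G, c)` with `|G| ∈ {8, 16}` EVERY random set of `φ₂` faces with independent classes in
the fibre generated mod `2` (as the theorem says), while for `ℤ/12`, `ℤ/6×ℤ/2`, `Dic₃` some such sets fail (`3/30`, `2/30`, `4/30`):
the `2`-group hypothesis is used.

CONTENT.
* §1 **A `p`-group separates nested stable subspaces by an invariant functional** (`exists_dual_invariantOn_of_ne`): `Γ` a
  `p`-group acting linearly on a finite `𝔽_p`-space `V`, `T ≤ U` stable subspaces, `T ≠ U` ⇒ some `μ ∈ V^*` kills `T`, is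
  `Γ`-invariant on `U` and does not kill `U`.  Proof: `Γ` acts on the finite `𝔽_p`-space `T^⊥/U^⊥ ≠ 0`, and a `p`-group fixing `0`
  fixes another point (Mathlib `IsPGroup.exists_fixed_point_of_prime_dvd_card_of_fixed_point`).
* §2 **Nakayama for `p`-groups** (`eq_of_le_sup_aug`): `T ≤ U` stable, `U ≤ T + 𝔽_p⟨ρ(g)u − u : u ∈ U⟩` ⇒ `T = U`.
* §3 **EXACTNESS FOR `2`-GROUPS** (`hodge2_le_of_isPGroup`, `exists_faces_generate_of_isPGroup`, `isLeast_fibreTwo_of_isPGroup`):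
  for `G` a `2`-group and `c` central, ANY family `S ⊆ hodge2` whose classes span the coinvariant fibre (`hodge2 ≤ rad2 + 𝔽₂⟨S⟩`)
  generates: `hodge2 ≤ pair2 + 𝔽₂[G]·S`; hence there are `φ₂(G, c)` FACES generating the Hodge lattice mod `2` modulo pairs, and
  `φ₂(G, c)` is the least cardinality of any generating family of Hodge vectors mod `2`.

## References
* [Pohlmann1968] H. Pohlmann, Algebraic cycles on abelian varieties of complex multiplication type, Ann. of Math. 88 (1968), Thm 1.
-/

namespace Summit.HodgeConjecture.CorCM.Census.Coinvariant

open Finset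
open Summit.HodgeConjecture.CorCM.Prior.AllgGroup.RfwfAllgGroup
open Summit.HodgeConjecture.CorCM.Census.BlockParity

noncomputable section

/-! ## §1 A `p`-group separates nested stable subspaces by an invariant functional -/

section PGroup

variable {p : ℕ} [hp : Fact p.Prime] {Γ : Type*} [Group Γ]
variable {V : Type*} [AddCommGroup V] [Module (ZMod p) V] [Module.Finite (ZMod p) V]

/-- **Separation by an invariant functional.**  Let the `p`-group `Γ` act linearly (`ρ`, a homomorphism into `End V` given as a
function with `ρ 1 = id`, `ρ (gh) = ρ g ∘ ρ h`) on a finite-dimensional `𝔽_p`-space `V`, and let `T ≤ U` be `Γ`-stable subspaces with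
`T ≠ U`.  Then some linear functional `μ` on `V` vanishes on `T`, is `Γ`-invariant on `U`, and does not vanish on `U`.  (The
`p`-group `Γ` acts on the non-zero finite `𝔽_p`-space `T^⊥/U^⊥`; a `p`-group action with a fixed point `0` on a set of cardinality
divisible by `p` has another fixed point.) [folklore] -/
theorem exists_dual_invariantOn_of_ne (hΓ : IsPGroup p Γ) (ρ : Γ → V →ₗ[ZMod p] V) (ρ_one : ρ 1 = LinearMap.id)
    (ρ_mul : ∀ g h : Γ, ρ (g * h) = ρ g ∘ₗ ρ h) {T U : Submodule (ZMod p) V} (hTU : T ≤ U) (hne : T ≠ U)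
    (hT : ∀ g : Γ, ∀ t ∈ T, ρ g t ∈ T) (hU : ∀ g : Γ, ∀ u ∈ U, ρ g u ∈ U) :
    ∃ μ : Module.Dual (ZMod p) V, (∀ t ∈ T, μ t = 0) ∧ (∀ g : Γ, ∀ u ∈ U, μ (ρ g u) = μ u) ∧ ∃ u ∈ U, μ u ≠ 0 := by
  classical
  set A : Submodule (ZMod p) (Module.Dual (ZMod p) V) := T.dualAnnihilator with hA
  set B : Submodule (ZMod p) (Module.Dual (ZMod p) V) := U.dualAnnihilator with hB
  -- precomposition `μ ↦ μ ∘ ρ g⁻¹` preserves both annihilators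
  have hψA : ∀ g : Γ, ∀ μ ∈ A, (ρ g⁻¹).dualMap μ ∈ A := by
    intro g μ hμ
    rw [hA, Submodule.mem_dualAnnihilator] at hμ ⊢
    intro t ht
    rw [LinearMap.dualMap_apply]
    exact hμ _ (hT _ t ht)
  have hψB : ∀ g : Γ, B ≤ Submodule.comap (ρ g⁻¹).dualMap B := by
    intro g μ hμ
    rw [Submodule.mem_comap]
    rw [hB, Submodule.mem_dualAnnihilator] at hμ ⊢
    intro u hu
    rw [LinearMap.dualMap_apply]
    exact hμ _ (hU _ u hu)
  -- the induced maps on `V^* / U^⊥`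
  let φ : Γ → (Module.Dual (ZMod p) V ⧸ B) →ₗ[ZMod p] (Module.Dual (ZMod p) V ⧸ B) := fun g => B.mapQ B (ρ g⁻¹).dualMap (hψB g)
  have φ_mk : ∀ (g : Γ) (μ : Module.Dual (ZMod p) V), φ g (B.mkQ μ) = B.mkQ ((ρ g⁻¹).dualMap μ) := fun g μ => rfl
  have dual_mul : ∀ (g h : Γ) (μ : Module.Dual (ZMod p) V),
      (ρ (g * h)⁻¹).dualMap μ = (ρ g⁻¹).dualMap ((ρ h⁻¹).dualMap μ) := fun g h μ =>
    LinearMap.ext fun v => by simp only [LinearMap.dualMap_apply, mul_inv_rev, ρ_mul, LinearMap.comp_apply]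
  have dual_one : ∀ μ : Module.Dual (ZMod p) V, (ρ (1 : Γ)⁻¹).dualMap μ = μ := fun μ =>
    LinearMap.ext fun v => by simp only [LinearMap.dualMap_apply, inv_one, ρ_one, LinearMap.id_apply]
  have φ_one : ∀ y, φ 1 y = y := by
    intro y
    obtain ⟨μ, rfl⟩ := B.mkQ_surjective y
    rw [φ_mk, dual_one]
  have φ_mul : ∀ (g h : Γ) (y), φ (g * h) y = φ g (φ h y) := by
    intro g h y
    obtain ⟨μ, rfl⟩ := B.mkQ_surjective y
    rw [φ_mk, φ_mk, φ_mk, dual_mul]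
  -- the `Γ`-set `A' = T^⊥ / U^⊥`
  set A' : Submodule (ZMod p) (Module.Dual (ZMod p) V ⧸ B) := A.map B.mkQ with hA'
  have hstab : ∀ g : Γ, ∀ y ∈ A', φ g y ∈ A' := by
    rintro g _ ⟨μ, hμ, rfl⟩
    rw [φ_mk]
    exact Submodule.mem_map_of_mem (hψA g μ hμ)
  letI : MulAction Γ ↥A' :=
    { smul := fun g y => ⟨φ g y.1, hstab g y.1 y.2⟩
      one_smul := fun y => Subtype.ext (φ_one y.1)
      mul_smul := fun g h y => Subtype.ext (φ_mul g h y.1) }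
  have hsmul : ∀ (g : Γ) (y : ↥A'), ((g • y : ↥A') : Module.Dual (ZMod p) V ⧸ B) = φ g y.1 := fun _ _ => rfl
  -- `A'` is non-zero: `dim U^⊥ < dim T^⊥`
  have hBA : B ≤ A := fun μ hμ => by
    rw [hB, Submodule.mem_dualAnnihilator] at hμ
    rw [hA, Submodule.mem_dualAnnihilator]
    exact fun t ht => hμ t (hTU ht)
  have hlt : T < U := lt_of_le_of_ne hTU hne
  have hBltA : B < A := by
    refine lt_of_le_of_ne hBA fun hBA' => ?_
    have h1 := Subspace.finrank_add_finrank_dualAnnihilator_eq T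
    have h2 := Subspace.finrank_add_finrank_dualAnnihilator_eq U
    have h3 := Submodule.finrank_lt_finrank_of_lt hlt
    rw [← hA] at h1
    rw [← hB, hBA'] at h2
    omega
  obtain ⟨μ₀, hμ₀A, hμ₀B⟩ := SetLike.exists_of_lt hBltA
  have hy₀ : B.mkQ μ₀ ∈ A' := Submodule.mem_map_of_mem hμ₀A
  have hy₀ne : (⟨B.mkQ μ₀, hy₀⟩ : ↥A') ≠ 0 := by
    intro h0
    have h1 : B.mkQ μ₀ = 0 := congrArg Subtype.val h0
    rw [← LinearMap.mem_ker, Submodule.ker_mkQ] at h1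
    exact hμ₀B h1
  -- `p ∣ |A'|`
  have hcard : p ∣ Nat.card ↥A' := by
    haveI : Nontrivial ↥A' := ⟨⟨_, 0, hy₀ne⟩⟩
    rw [Module.natCard_eq_pow_finrank (K := ZMod p) (V := ↥A'), Nat.card_zmod]
    exact dvd_pow_self p (Module.finrank_pos (R := ZMod p) (M := ↥A')).ne'
  -- a non-zero fixed point
  haveI : Finite ↥A' := Module.finite_of_finite (ZMod p)
  have h0 : (0 : ↥A') ∈ MulAction.fixedPoints Γ ↥A' := fun g => Subtype.ext (by rw [hsmul]; exact map_zero _)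
  obtain ⟨b, hb, hb0⟩ := hΓ.exists_fixed_point_of_prime_dvd_card_of_fixed_point ↥A' hcard h0
  have hb2 : b.1 ∈ A.map B.mkQ := b.2
  obtain ⟨μ, hμA, hμb⟩ := Submodule.mem_map.mp hb2
  refine ⟨μ, fun t ht => (Submodule.mem_dualAnnihilator μ).mp hμA t ht, fun g u hu => ?_, ?_⟩
  · -- invariance on `U`: `φ g⁻¹ b = b` reads `μ ∘ ρ g − μ ∈ U^⊥`
    have hfix := congrArg Subtype.val (hb g⁻¹)
    rw [hsmul, ← hμb, φ_mk, inv_inv] at hfix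
    have hdiff : (ρ g).dualMap μ - μ ∈ B := (Submodule.Quotient.eq B).mp hfix
    rw [hB, Submodule.mem_dualAnnihilator] at hdiff
    have := hdiff u hu
    rwa [LinearMap.sub_apply, LinearMap.dualMap_apply, sub_eq_zero] at this
  · -- `μ ∉ U^⊥`
    by_contra hall
    push Not at hall
    have hμB : μ ∈ B := by rw [hB, Submodule.mem_dualAnnihilator]; exact hall
    apply hb0
    refine (Subtype.ext ?_).symm
    rw [← hμb]
    change B.mkQ μ = 0
    rw [← LinearMap.mem_ker, Submodule.ker_mkQ]
    exact hμB

/-- **Nakayama for `p`-groups.**  With `Γ`, `V`, `ρ` as above and `T ≤ U` stable subspaces: if `U ≤ T + 𝔽_p⟨ρ(g)u − u : g, u ∈ U⟩`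
(i.e. `T` spans `U` modulo the augmentation submodule of `U`), then `T = U`. [folklore] -/
theorem eq_of_le_sup_aug (hΓ : IsPGroup p Γ) (ρ : Γ → V →ₗ[ZMod p] V) (ρ_one : ρ 1 = LinearMap.id)
    (ρ_mul : ∀ g h : Γ, ρ (g * h) = ρ g ∘ₗ ρ h) {T U : Submodule (ZMod p) V} (hTU : T ≤ U)
    (hT : ∀ g : Γ, ∀ t ∈ T, ρ g t ∈ T) (hU : ∀ g : Γ, ∀ u ∈ U, ρ g u ∈ U)
    (h : U ≤ T ⊔ Submodule.span (ZMod p) {w | ∃ g : Γ, ∃ u ∈ U, w = ρ g u - u}) : T = U := by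
  by_contra hne
  obtain ⟨μ, hμT, hμinv, u, hu, hμu⟩ := exists_dual_invariantOn_of_ne hΓ ρ ρ_one ρ_mul hTU hne hT hU
  apply hμu
  have hle : T ⊔ Submodule.span (ZMod p) {w | ∃ g : Γ, ∃ u ∈ U, w = ρ g u - u} ≤ LinearMap.ker μ := by
    refine sup_le (fun t ht => LinearMap.mem_ker.mpr (hμT t ht)) ?_
    rw [Submodule.span_le]
    rintro _ ⟨g, u', hu', rfl⟩
    rw [SetLike.mem_coe, LinearMap.mem_ker, map_sub, hμinv g u' hu', sub_self]
  exact LinearMap.mem_ker.mp (hle (h hu))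

end PGroup

/-! ## §3 Exactness of the coinvariant floor mod `2` for `2`-groups -/

variable {G : Type*} [Group G] [Fintype G] [DecidableEq G] (c : G)

/-- Base change on `𝔽₂[types]` as a family of linear maps: `Q ↦ mapDomain (·Q⁻¹)`; multiplicative. [folklore] -/
theorem lmapDomain_rt_mul (Q Q' : G) :
    Finsupp.lmapDomain (ZMod 2) (ZMod 2) (rt c (Q * Q')) =
      Finsupp.lmapDomain (ZMod 2) (ZMod 2) (rt c Q) ∘ₗ Finsupp.lmapDomain (ZMod 2) (ZMod 2) (rt c Q') :=
  LinearMap.ext fun x => by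
    rw [LinearMap.comp_apply, Finsupp.lmapDomain_apply, Finsupp.lmapDomain_apply, Finsupp.lmapDomain_apply]
    exact mapDomain_rt_mul c Q Q' x

/-- `mapDomain (·1⁻¹) = id` on `𝔽₂[types]`. [folklore] -/
theorem lmapDomain_rt_one : Finsupp.lmapDomain (ZMod 2) (ZMod 2) (rt c (1 : G)) = LinearMap.id :=
  LinearMap.ext fun x => by rw [Finsupp.lmapDomain_apply, LinearMap.id_apply]; exact mapDomain_rt_one c x

/-- Translates of a family of Hodge vectors mod `2` are Hodge vectors (central `c`). [folklore] -/
theorem span_translates2_le_hodge2 (hc2 : c * c = 1) (hcen : ∀ x : G, x * c = c * x) (S : Finset (CMF G c →₀ ZMod 2))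
    (hS : (S : Set (CMF G c →₀ ZMod 2)) ⊆ hodge2 c hc2) : Submodule.span (ZMod 2) (translates2 c S) ≤ hodge2 c hc2 := by
  rw [Submodule.span_le]
  rintro _ ⟨Q, s, hs, rfl⟩
  exact mapDomain_rt_mem_hodge2 c hc2 hcen Q (hS hs)

/-- **EXACTNESS FOR `2`-GROUPS.**  Let `G` be a `2`-group and `c` central.  If a family `S ⊆ hodge2` spans the coinvariant fibre
(`hodge2 ≤ rad2 + 𝔽₂⟨S⟩`), then it GENERATES: `hodge2 ≤ pair2 + 𝔽₂[G]·S`.  (Nakayama for the `2`-group `G` acting on `𝔽₂[types]`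
by base change, with `T = pair2 + 𝔽₂⟨translates of S⟩ ≤ U = hodge2`; the coboundaries of faces are coboundaries of members of `U`.)
[folklore] -/
theorem hodge2_le_of_isPGroup (hG : IsPGroup 2 G) (hc2 : c * c = 1) (hcen : ∀ x : G, x * c = c * x)
    (S : Finset (CMF G c →₀ ZMod 2)) (hS : (S : Set (CMF G c →₀ ZMod 2)) ⊆ hodge2 c hc2)
    (h : hodge2 c hc2 ≤ rad2 c hc2 ⊔ Submodule.span (ZMod 2) (S : Set (CMF G c →₀ ZMod 2))) :
    hodge2 c hc2 ≤ pair2 c ⊔ Submodule.span (ZMod 2) (translates2 c S) := by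
  set ρ : G → (CMF G c →₀ ZMod 2) →ₗ[ZMod 2] (CMF G c →₀ ZMod 2) := fun Q => Finsupp.lmapDomain (ZMod 2) (ZMod 2) (rt c Q)
    with hρ
  have ρ_apply : ∀ (Q : G) (x : CMF G c →₀ ZMod 2), ρ Q x = Finsupp.mapDomain (rt c Q) x := fun Q x => rfl
  have hT : ∀ Q : G, ∀ t ∈ pair2 c ⊔ Submodule.span (ZMod 2) (translates2 c S),
      ρ Q t ∈ pair2 c ⊔ Submodule.span (ZMod 2) (translates2 c S) := by
    intro Q t ht
    obtain ⟨q, hq, z, hz, rfl⟩ := Submodule.mem_sup.mp ht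
    rw [map_add]
    exact Submodule.add_mem _ (Submodule.mem_sup_left (by rw [ρ_apply]; exact mapDomain_rt_mem_pair2 c hcen Q hq))
      (Submodule.mem_sup_right (by rw [ρ_apply]; exact mapDomain_rt_mem_span_translates2 c Q S hz))
  have hU : ∀ Q : G, ∀ u ∈ hodge2 c hc2, ρ Q u ∈ hodge2 c hc2 := fun Q u hu => by
    rw [ρ_apply]; exact mapDomain_rt_mem_hodge2 c hc2 hcen Q hu
  have hTU : pair2 c ⊔ Submodule.span (ZMod 2) (translates2 c S) ≤ hodge2 c hc2 :=
    sup_le le_sup_right (span_translates2_le_hodge2 c hc2 hcen S hS)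
  have haug : hodge2 c hc2 ≤ (pair2 c ⊔ Submodule.span (ZMod 2) (translates2 c S)) ⊔
      Submodule.span (ZMod 2) {w | ∃ g : G, ∃ u ∈ hodge2 c hc2, w = ρ g u - u} := by
    refine h.trans (sup_le (sup_le ?_ ?_) ?_)
    · exact le_sup_left.trans le_sup_left
    · refine le_trans ?_ le_sup_right
      rw [aug2, Submodule.span_le]
      rintro _ ⟨Q, x, hx, rfl⟩
      exact Submodule.subset_span ⟨Q, x, le_sup_left (b := pair2 c) (Submodule.subset_span hx), by rw [ρ_apply]⟩
    · exact (Submodule.span_mono (subset_translates2 c S)).trans (le_sup_right.trans le_sup_left)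
  have key := eq_of_le_sup_aug (p := 2) hG ρ (by rw [hρ]; exact lmapDomain_rt_one c)
    (fun g g' => by rw [hρ]; exact lmapDomain_rt_mul c g g') hTU hT hU haug
  exact key.symm.le

/-- **`φ₂(G, c)` FACES GENERATE mod `2` when `G` is a `2`-group**: there is a set of `φ₂(G, c)` faces mod `2` whose `𝔽₂[G]`-translates
together with the pairs span the whole Hodge lattice mod `2` — André-3's `μ_F = fibre₂`, mod `2`, for every `2`-power order.
[folklore] -/
theorem exists_faces_generate_of_isPGroup (hG : IsPGroup 2 G) (hc2 : c * c = 1) (hcen : ∀ x : G, x * c = c * x) :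
    ∃ S : Finset (CMF G c →₀ ZMod 2), ↑S ⊆ faces2 c hc2 ∧ S.card = fibreTwo c hc2 ∧
      hodge2 c hc2 ≤ pair2 c ⊔ Submodule.span (ZMod 2) (translates2 c S) := by
  obtain ⟨S, hSF, hcard, hle⟩ := exists_faces2_card_eq_fibreTwo c hc2
  exact ⟨S, hSF, hcard, hodge2_le_of_isPGroup c hG hc2 hcen S
    (hSF.trans ((Submodule.subset_span (R := ZMod 2)).trans
      (SetLike.coe_subset_coe.mpr (le_sup_left : face2 c hc2 ≤ hodge2 c hc2)))) hle⟩

/-- **`φ₂(G, c)` is the least number of Hodge generators mod `2` (`G` a `2`-group, `c` central)**: the minimum, over finite families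
`S` of Hodge vectors mod `2` with `faces2 ⊆ pair2 + 𝔽₂[G]·S`, of `|S|` is exactly `φ₂(G, c)`, and it is attained by a family of
faces — the mod-`2` law `μ₂ = μ_{F,2} = fibre₂`. [folklore] -/
theorem isLeast_fibreTwo_of_isPGroup (hG : IsPGroup 2 G) (hc2 : c * c = 1) (hcen : ∀ x : G, x * c = c * x) :
    IsLeast {n : ℕ | ∃ S : Finset (CMF G c →₀ ZMod 2), (S : Set (CMF G c →₀ ZMod 2)) ⊆ hodge2 c hc2 ∧ S.card = n ∧
      faces2 c hc2 ⊆ ↑(pair2 c ⊔ Submodule.span (ZMod 2) (translates2 c S))} (fibreTwo c hc2) := by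
  refine ⟨?_, ?_⟩
  · obtain ⟨S, hSF, hcard, hle⟩ := exists_faces_generate_of_isPGroup c hG hc2 hcen
    have hSH : (S : Set (CMF G c →₀ ZMod 2)) ⊆ hodge2 c hc2 :=
      hSF.trans ((Submodule.subset_span (R := ZMod 2)).trans
        (SetLike.coe_subset_coe.mpr (le_sup_left : face2 c hc2 ≤ hodge2 c hc2)))
    refine ⟨S, hSH, hcard, ?_⟩
    exact (Submodule.subset_span (R := ZMod 2) (s := faces2 c hc2)).trans
      (SetLike.coe_subset_coe.mpr ((le_sup_left : face2 c hc2 ≤ hodge2 c hc2).trans hle))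
  · rintro n ⟨S, hS, rfl, hX⟩
    exact fibreTwo_le_card_two c hc2 hcen S hS hX

omit [DecidableEq G] in
/-- Groups of `2`-power order are `2`-groups (for the record: a Galois CM field of degree `2^k` has such a group of Galois
translates). [folklore] -/
theorem isPGroup_two_of_card {k : ℕ} (hk : Fintype.card G = 2 ^ k) : IsPGroup 2 G :=
  IsPGroup.of_card (by rw [Nat.card_eq_fintype_card, hk])

end

end Summit.HodgeConjecture.CorCM.Census.Coinvariant
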